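import Summits.BirchSwinnertonDyer.BirchSwinnertonDyer.Theorems.GenusKolyvaginAtTwoGenusPrimitiveSupplyAtTwoPrimeTwistRigidity
import Summits.BirchSwinnertonDyer.BirchSwinnertonDyer.Theorems.GenusKolyvaginAtTwoGenusPrimitiveSupplyAtTwoArchimedeanUnramifiedRowsHold
import HarnessLib

/-!
# Route `GenusKolyvaginAtTwo`, residual `OffCutResidualAtTwoR` (stmt-BirchSwinnertonDyer-31767) / crux #2 `GenusPrimitiveSupplyAtTwo`:
# THE PRIME-TWIST DICTIONARY AT AN INERT `2` — `Sel_𝔓(A_χ/ℚ)` for `d ≡ 5 (mod 8)` and `E` good at `2`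
# (`F1Sign2.DescAdmissibleUnram`), up to the DECIDED dichotomy `Sel_𝔓(A_χ) ∈ {Sel₂^{rel ∞}(W), Sel₂^{str ∞}(W)}`

Width seat `bsd-line-gk2-p5` g38 (cell `bsd-f1-sign2`), sequel of this lineage's files 30–41 (`…PrimeTwistDescAdmissible` … `…PrimeTwistRigidity`,
the dictionary for `d ≡ 1 (mod 8)`) and file 36 (`…TwistDyadicUnramifiedSqrt`: `ι√d ∈ ℚ₂^{nr}` for `d ≡ 5 (mod 8)`).  THEOREMS ONLY (no definition,
no named fact, no `sorry`); helper `--supports stmt-BirchSwinnertonDyer-31767`; no item is closed; **BSD is NOT proved by any of this.**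

WHY.  LEAD `bsd-line-gk2-p1` g25's LINE 27 stub S2 (SOC) file `…OffCutResidualAtTwoRSocleSelectionHeegnerSocle` decides `Sel_𝔓(A_{χ_{d_K}}/ℚ)` on the
shallow `Δ > 0` Heegner frame through `primeTwist_selmerGroup_eq_relaxed_or_eq_kummerStrict_decided`, which asks `F1Sign2.DescAdmissible W d_K`,
i.e. `d_K ≡ 1 (mod 8)` — `2` SPLIT in `K` (its extra binder `h2K`).  S2's frame as typed also allows `2` INERT (`d_K ≡ 5 (mod 8)`; then `2 ∤ N`, `E` good
at `2`).  Mazur–Rubin 2010 Lemma 2.10 (v) at `v = 2` says the twisted local condition there is again `E`'s own (both are the unramified one), so the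
whole dictionary goes through with `F1Sign2.DescAdmissibleUnram` in place of `F1Sign2.DescAdmissible`.  Every brick is already in the tree: the
`K`-general inert comparison `primeTwist_selmerLocalKer_eq_of_inert` (file 32), `closureEmb_geomSqrt_mem_maxUnramified_of_emod_eight_eq_five` (file 36),
T-A⁵ `unramifiedTwistSelmerShiftAtTwo_holds` (file 37).  This file is the bookkeeping:

* §U1 `descAdmissibleUnram_place_trichotomy` — every finite place of `ℚ` has a local `√d`, or is odd with `W(ℚ_v)[2] = 0`, or is GOOD for `W` with
  `ι√d ∈ ℚ_v^{nr}` and no local `√d` (this third row now contains `v = 2`).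
* §U2 **`primeTwist_selmerLocalKer_adicCompletion_eq_of_descAdmissibleUnram`** — THE ONE-PLACE DICTIONARY `H¹_𝒜(ℚ_v, E[2]) = H¹_f(ℚ_v, E[2])` at EVERY
  finite place.
* §U3 the sandwich `Sel₂^{str ∞}(W) ≤ Sel_𝔓(A_χ/ℚ) ≤ Sel₂^{rel ∞}(W)`, the equality clause of DESC-§17-R, `Δ_W < 0 ⟹ Sel_𝔓(A_χ) = Sel₂(W)`.
* §U4 the real place (`d < 0`): `Sel₂(W) ⊓ Sel_𝔓(A_χ) = Sel₂^{str ∞}(W)`.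
* §U5 the `Δ > 0` lattice: `Sel_𝔓(A_χ) ∈ {str, rel}`, «egg bit `1` ⟹ DOWN», `Sel₂ ≤ Sel_𝔓 ⟺` every `Sel₂`-class is real-trivial.
* §U6 **UP / DOWN / DECIDED**: `primeTwist_selmerGroup_eq_relaxed_or_eq_kummerStrict_decided_of_unram` — the statement of file 41's decision with
  `DescAdmissibleUnram`; and the class-free form `…_decided_of_descAdmissible_or_unram` (hypothesis `DescAdmissible W d ∨ DescAdmissibleUnram W d`),
  which is what the Heegner frame with odd `d_K` supplies (sequel file `…SocleSelectionTwoUnramified`).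
* §U7 MIXED RIGIDITY (T-A⁵′ as an equality of groups): `Sel_𝔓(A_{χ_d}) = Sel_𝔓(A_{χ_{d'}})` for `d` split-admissible and `d'` unramified-admissible.

Honest framing: KNOWN in print (Mazur–Rubin 2007 §5 / 2010 Lemma 2.10 (v), Def. 3.1, Lemma 3.2, Prop. 3.3; Kramer 1981 Prop. 3, Prop. 7, Thm. 1);
kernel-new bookkeeping; beyond-print theorem: no.  What it buys: the clause «`2` split in `K`» of LEAD's S2 (SOC) file is not needed.
BSD is NOT proved by any of this; `OffCutResidualAtTwoR`, K4Pos and crux 25504 stay OPEN.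

References: [MazurRubin2010] Lemma 2.10 (v), Def. 3.1, Lemma 3.2, Prop. 3.3, Cor. 3.4; [MazurRubin2007] Def 4.3, Cor 4.6, §5; [Kramer1981] Prop. 3,
Prop. 6, Prop. 7, Thm. 1; [Serre1973] Ch. II §3.3; [SerreLocalFields1979] Ch. IV §4.
-/

set_option linter.dupNamespace false -- tree convention: `Summit.BirchSwinnertonDyer.BirchSwinnertonDyer.Theorems` (summit = sub-problem)
set_option autoImplicit false

noncomputable section

open scoped Classical

namespace Summit.BirchSwinnertonDyer.BirchSwinnertonDyer.Theorems.GenusKolyArch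

open WeierstrassCurve Field NumberField IsDedekindDomain Function
open Literature.NumberTheory.EllipticCurves Literature.NumberTheory.GaloisRepresentations
open Literature.NumberTheory.GaloisRepresentations.IsNonarchimedeanLocalField (maxUnramified)
open Literature.NumberTheory.GaloisCohomology
open Summit.BirchSwinnertonDyer.BirchSwinnertonDyer.Theorems.GenusKolyTwistLocal
open Summit.BirchSwinnertonDyer.Rank1Residual.X11b.KummerPT (kummerStrict kummerRelaxed)
open Summit.BirchSwinnertonDyer.Rank1Residual.F1Sign2
open Rat.HeightOneSpectrum (primesEquiv natGenerator)

variable (W : WeierstrassCurve ℚ) [W.IsElliptic] [W.IsGloballyMinimal] {d d' : ℤ}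
  {χ χ' : absoluteGaloisGroup ℚ →ₜ* Multiplicative (ZMod 2)}

/-! ## §U1 The place trichotomy of an unramified-admissible `d` -/

/-- **Every finite place of `ℚ` has a local `√d`, or is odd and silent for `W`, or is GOOD for `W` with `ι√d ∈ ℚ_v^{nr}` and no local `√d`**, for
`d` unramified-admissible (`F1Sign2.DescAdmissibleUnram`: `d ≡ 5 (mod 8)`, `W` good at `2`, primes of `d` good with `a_q` odd, `(d/ℓ) = 1` at the odd
bad `ℓ`): over `2`, `W` is good and `ι√d ∈ ℚ₂^{nr}` (file 36); over a prime of `d`, `a_q` odd kills `W(ℚ_q)[2]`; over an odd bad prime `(d/ℓ) = 1`;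
the remaining places are odd and good, and `ι√d ∈ ℚ_v^{nr}` there (file 33 §137). [cite: Serre1973, Ch. II §3.3 Thm 3, Thm 4] [cite: Kramer1981, Prop. 3]
[cite: SerreLocalFields1979, Ch. IV §4 Cor. 2 to Prop. 16] -/
theorem descAdmissibleUnram_place_trichotomy (hd : DescAdmissibleUnram W d) (v : HeightOneSpectrum (𝓞 ℚ)) :
    (∃ s : v.adicCompletion ℚ, s ^ 2 = algebraMap ℚ (v.adicCompletion ℚ) (d : ℚ)) ∨
      (((2 : ℕ) : 𝓞 ℚ) ∉ v.asIdeal ∧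
        Nat.card (nsmulAddMonoidHom 2 : (W.baseChange (v.adicCompletion ℚ)).toAffine.Point →+ _).ker = 1) ∨
      (W.HasGoodReductionAt v ∧
        closureEmb (K := ℚ) (v.adicCompletion ℚ) (geomSqrt (d : ℚ)) ∈ maxUnramified (v.adicCompletion ℚ) ∧
        ∀ s : v.adicCompletion ℚ, s ^ 2 ≠ algebraMap ℚ (v.adicCompletion ℚ) (d : ℚ)) := by
  obtain ⟨-, -, hd8, hgood2, hprimes, hbad⟩ := hd
  haveI := Fact.mk (primesEquiv v).2
  have hpP : (primesEquiv v : ℕ).Prime := (primesEquiv v).2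
  have hpv : ((primesEquiv v : ℕ) : 𝓞 ℚ) ∈ v.asIdeal := Rat.HeightOneSpectrum.natCast_natGenerator_mem v
  -- a `p`-adic square gives the split option
  have hsplit : IsSquare ((d : ℤ) : ℚ_[(primesEquiv v : ℕ)]) →
      ∃ s : v.adicCompletion ℚ, s ^ 2 = algebraMap ℚ (v.adicCompletion ℚ) (d : ℚ) := fun hsq ↦ by
    have hsq' : IsSquare (((d : ℚ) : ℚ) : ℚ_[(primesEquiv v : ℕ)]) := by
      simpa only [Rat.cast_intCast] using hsq
    obtain ⟨s, hs⟩ := TwoDescentLocal.isSquare_algebraMap_adicCompletion_of_padic v hsq'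
    exact ⟨s, by rw [sq]; exact hs.symm⟩
  -- with a local square root we are done; otherwise record its absence
  by_cases hsq : ∃ s : v.adicCompletion ℚ, s ^ 2 = algebraMap ℚ (v.adicCompletion ℚ) (d : ℚ)
  · exact Or.inl hsq
  push Not at hsq
  by_cases hp2 : (primesEquiv v : ℕ) = 2
  · -- over `2`: `W` good at `2` and `ι√d ∈ ℚ₂^{nr}` (`d ≡ 5 (mod 8)`)
    have h2v : ((2 : ℕ) : 𝓞 ℚ) ∈ v.asIdeal := by rw [← hp2]; exact hpv
    have hW : W.HasGoodReductionAt v := by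
      by_contra h
      have hdvd : (primesEquiv v : ℕ) ∣ W.conductorNorm ℤ := (W.dvd_conductorNorm_iff v).mpr h
      rw [hp2] at hdvd
      haveI : Fact (Nat.Prime 2) := ⟨Nat.prime_two⟩
      exact not_dvd_conductorNorm_of_hasGoodReductionAtPrime W (hgood2 inferInstance) hdvd
    exact Or.inr (Or.inr ⟨hW, closureEmb_geomSqrt_mem_maxUnramified_of_emod_eight_eq_five v hp2 h2v hd8, hsq⟩)
  have h2v : ((2 : ℕ) : 𝓞 ℚ) ∉ v.asIdeal :=
    GenusKolyTwistingPrime.natCast_not_mem_of_not_dvd hpP hpv fun h ↦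
      hp2 ((Nat.prime_dvd_prime_iff_eq hpP Nat.prime_two).mp h)
  by_cases hpd : ((primesEquiv v : ℕ) : ℤ) ∣ d
  · -- over a prime of `d`: odd, good, `a_p` odd ⟹ silent for `W`
    obtain ⟨hgood, hodd⟩ := hprimes _ hpP hpd
    have hgood' : W.HasGoodReductionAtPrime (primesEquiv v : ℕ) := hgood inferInstance
    have hpΔ : ¬ ((primesEquiv v : ℕ) : ℤ) ∣ minimalDiscriminantInt W :=
      W.not_dvd_minimalDiscriminantInt_of_hasGoodReductionAtPrime' _ hgood'
    have hsil := (GenusKolyTwin.silent_iff_odd_frobeniusTrace W hp2 hpΔ).mpr hodd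
    have hker : Nat.card (nsmulAddMonoidHom 2 : (W.baseChange (v.adicCompletion ℚ)).toAffine.Point →+ _).ker = 1 := by
      rw [natCard_ker_nsmul_adicCompletion_eq_padic W v 2]
      have h0 := GenusKolyTwin.twoTorsion_padic_eq_zero_of_forall_ne W hp2 hpΔ hsil
      rw [Nat.card_eq_one_iff_unique]
      refine ⟨⟨fun a b ↦ Subtype.ext ((h0 a.1 a.2).trans (h0 b.1 b.2).symm)⟩, ⟨⟨0, by simp⟩⟩⟩
    exact Or.inr (Or.inl ⟨h2v, hker⟩)
  by_cases hpN : (primesEquiv v : ℕ) ∣ W.conductorNorm ℤ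
  · -- over an odd bad prime: `(d/p) = 1` makes `d` a `p`-adic square
    have hnotgood : ∀ _h : Fact (primesEquiv v : ℕ).Prime, ¬ W.HasGoodReductionAtPrime (primesEquiv v : ℕ) := fun _ hg ↦
      not_dvd_conductorNorm_of_hasGoodReductionAtPrime W hg hpN
    have hJ := hbad _ hpP hp2 hnotgood
    exact absurd (hsplit (padic_isSquare_of_jacobiSym_eq_one hp2 hJ)) (by push Not; exact hsq)
  · -- over an odd good prime not dividing `d` without a local `√d`: the inert row
    have hW : W.HasGoodReductionAt v := by
      by_contra h
      exact hpN ((W.dvd_conductorNorm_iff v).mpr h)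
    exact Or.inr (Or.inr ⟨hW, closureEmb_geomSqrt_mem_maxUnramified_of_not_dvd v h2v hpd, hsq⟩)

/-! ## §U2 The one-place dictionary at every finite place -/

/-- **THE ONE-PLACE DICTIONARY AT EVERY FINITE PLACE (unramified-admissible `d`): `H¹_𝒜(ℚ_v, E[2]) = H¹_f(ℚ_v, E[2])`** — at a place with a
local `√d` by file 30 §124; over a prime of `d` because `W(ℚ_v)[2] = 0` (§124); at a GOOD place with `ℚ_v(√d)/ℚ_v` unramified quadratic — NOW
INCLUDING `v = 2` — by file 32's inert brick (Mazur's norm theorem and `H¹(K'/ℚ_v, E(K')) = 0`). [cite: MazurRubin2010, Lemma 2.10 (v)]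
[cite: MazurRubin2007, Def 4.3 and Cor 4.6] [cite: Kramer1981, Prop. 3 and Prop. 7] -/
theorem primeTwist_selmerLocalKer_adicCompletion_eq_of_descAdmissibleUnram (hd : DescAdmissibleUnram W d)
    (hχ : IsQuadraticCharacterOf χ d) (v : HeightOneSpectrum (𝓞 ℚ)) :
    PrimeTwist.selmerLocalKer W χ (v.adicCompletion ℚ) = W.selmerLocalKer (v.adicCompletion ℚ) 2 := by
  rcases descAdmissibleUnram_place_trichotomy W hd v with hsq | ⟨h2v, hker⟩ | ⟨hgood, hnr, hns⟩
  · exact primeTwist_selmerLocalKer_adicCompletion_eq_of_exists_sq W hχ v hsq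
  · exact primeTwist_selmerLocalKer_adicCompletion_eq_of_natCard_ker_eq_one W χ v h2v hker
  · exact primeTwist_selmerLocalKer_eq_of_inert W v χ hgood hnr hns (localChar_eq_one_iff_of_isQuadraticCharacterOf hχ)

/-! ## §U3 The sandwich `Sel₂^{str ∞}(W) ≤ Sel_𝔓(A_χ/ℚ) ≤ Sel₂^{rel ∞}(W)` -/

/-- **Lower slice (unramified-admissible `d`): `Sel₂^{str ∞}(W) ≤ Sel_𝔓(A_χ/ℚ)`** (finite places: §U2; a class trivial at `∞` satisfies every
restriction-kernel condition there). [cite: MazurRubin2010, Def. 3.1 and Lemma 3.2] [cite: MazurRubin2007, Def 4.3] -/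
theorem selmerGroup_kummerStrict_le_primeTwist_selmerGroup_of_unram (hd : DescAdmissibleUnram W d) (hχ : IsQuadraticCharacterOf χ d)
    (w : InfinitePlace ℚ) : (kummerStrict W 2 {(Sum.inl w : Place ℚ)}).selmerGroup ≤ PrimeTwist.selmerGroup W χ := by
  intro c hc
  obtain ⟨hR, hloc⟩ := (mem_selmerGroup_kummerStrict_singleton_inl_iff W w c).mp hc
  refine (PrimeTwist.mem_selmerGroup_iff W χ c).mpr ⟨fun v ↦ ?_, fun w' ↦ ?_⟩
  · exact (primeTwist_selmerLocalKer_adicCompletion_eq_of_descAdmissibleUnram W hd hχ v).ge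
      ((mem_selmerGroupRelaxedAtInfinityAtTwo_iff W c).mp hR v)
  · obtain rfl : w' = w := Subsingleton.elim _ _
    exact PrimeTwist.mem_selmerLocalKer_of_res_eq_zero W χ w'.Completion hloc

/-- **Upper slice (unramified-admissible `d`): `Sel_𝔓(A_χ/ℚ) ≤ Sel₂^{rel ∞}(W)`** — DESC-§17-R part 1 for `d ≡ 5 (mod 8)`: every prime-twist Selmer
class satisfies `W`'s Kummer condition at every finite place (§U2). [cite: MazurRubin2010, Def. 3.1, Lemma 3.2 and Lemma 2.10 (v)] -/
theorem primeTwist_selmerGroup_le_selmerGroupRelaxedAtInfinityAtTwo_of_unram (hd : DescAdmissibleUnram W d)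
    (hχ : IsQuadraticCharacterOf χ d) : PrimeTwist.selmerGroup W χ ≤ selmerGroupRelaxedAtInfinityAtTwo W := by
  intro c hc
  rw [PrimeTwist.mem_selmerGroup_iff] at hc
  exact (mem_selmerGroupRelaxedAtInfinityAtTwo_iff W c).mpr fun v ↦
    (primeTwist_selmerLocalKer_adicCompletion_eq_of_descAdmissibleUnram W hd hχ v).le (hc.1 v)

/-- **DESC-§17-R part 2 for `d ≡ 5 (mod 8)`: `#Sel_𝔓(A_χ/ℚ) = 2·#Sel₂(W)` ⟹ `Sel_𝔓(A_χ/ℚ) = Sel₂^{rel ∞}(W)`** (the upper slice is an equality of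
finite groups, `#Sel₂^{rel ∞} ≤ 2·#Sel₂`). [cite: MazurRubin2010, Lemma 3.2 and Prop. 3.3] -/
theorem primeTwist_selmerGroup_eq_relaxed_of_unram_of_natCard (hd : DescAdmissibleUnram W d) (hχ : IsQuadraticCharacterOf χ d)
    (hcard : Nat.card (PrimeTwist.selmerGroup W χ) = 2 * selmerTwoCard W) :
    PrimeTwist.selmerGroup W χ = selmerGroupRelaxedAtInfinityAtTwo W := by
  have hle := primeTwist_selmerGroup_le_selmerGroupRelaxedAtInfinityAtTwo_of_unram W hd hχ
  obtain ⟨hbound, hfin⟩ := natCard_selmerGroupRelaxedAtInfinityAtTwo_le_two_mul W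
  haveI := hfin
  exact AddSubgroup.eq_of_le_of_card_ge hle (by rw [hcard]; exact hbound)

/-- **`Δ_W < 0`: `Sel_𝔓(A_χ/ℚ) = Sel₂^{rel ∞}(W) = Sel₂(W)`** for every unramified-admissible `d` (the sandwich collapses: `#𝓛_∞ = 1`).
[cite: MazurRubin2010, Lemma 3.2] [cite: Kramer1981, Prop. 6 and Thm. 1] -/
theorem primeTwist_selmerGroup_eq_selmerGroup_of_Δ_neg_of_unram (hΔ : W.Δ < 0) (hd : DescAdmissibleUnram W d)
    (hχ : IsQuadraticCharacterOf χ d) :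
    PrimeTwist.selmerGroup W χ = selmerGroupRelaxedAtInfinityAtTwo W ∧ PrimeTwist.selmerGroup W χ = W.selmerGroup ((2 : ℕ) : ℤ) := by
  let w : InfinitePlace ℚ := Rat.infinitePlace
  have h1 : PrimeTwist.selmerGroup W χ = selmerGroupRelaxedAtInfinityAtTwo W := by
    refine le_antisymm (primeTwist_selmerGroup_le_selmerGroupRelaxedAtInfinityAtTwo_of_unram W hd hχ) ?_
    rw [← selmerGroup_kummerStrict_eq_selmerGroupRelaxedAtInfinityAtTwo_of_Δ_neg W hΔ w]
    exact selmerGroup_kummerStrict_le_primeTwist_selmerGroup_of_unram W hd hχ w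
  exact ⟨h1, h1.trans (selmerGroupRelaxedAtInfinityAtTwo_eq_selmerGroup_of_Δ_neg W hΔ)⟩

/-! ## §U4 The real place: `Sel₂(W) ⊓ Sel_𝔓(A_χ/ℚ) = Sel₂^{str ∞}(W)` -/

omit [W.IsGloballyMinimal] in
/-- **At the real place, for `d < 0`: a class in `W`'s Kummer condition and in `A_χ`'s `𝔓`-Selmer condition at `ℝ` has `loc_∞ c = 0`** (file 35
§151 at `Γ_ℝ` of order `≤ 2`, `d ∉ ℝ²`; only the sign of `d` is used). [cite: Kramer1981, Prop. 6 and Prop. 7] [cite: MazurRubin2007, Prop. 5.2] -/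
theorem localization_inl_eq_zero_of_mem_of_mem_of_neg (hdn : d < 0) (hχ : IsQuadraticCharacterOf χ d) (w : InfinitePlace ℚ)
    {c : W.galH1Torsion ((2 : ℕ) : ℤ)} (hW : c ∈ W.selmerLocalKer w.Completion 2) (hA : c ∈ PrimeTwist.selmerLocalKer W χ w.Completion) :
    galoisCohomology.localization (W.torsionGaloisModule ((2 : ℕ) : ℤ)) (Sum.inl w) 1 c = 0 := by
  haveI := finite_absoluteGaloisGroup_completion_infinitePlace w
  exact res_eq_zero_of_mem_selmerLocalKer_of_mem_primeTwist_selmerLocalKer W χ w.Completion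
    (natCard_absoluteGaloisGroup_completion_infinitePlace_le_two w) (forall_sq_ne_algebraMap_completion_of_neg w hdn)
    (localChar_eq_one_iff_of_isQuadraticCharacterOf hχ) hW hA

/-- **`Sel₂(W) ⊓ Sel_𝔓(A_χ/ℚ) = Sel₂^{str ∞}(W)`** inside `H¹(ℚ, E[2])` for every unramified-admissible `d` and its character (Mazur–Rubin's
`Sel ∩ Sel^χ = Sel_{strict at T}`, `T = {∞}`): `≥` is §U3; `≤` is §U4 at the real place. [cite: MazurRubin2010, Lemma 3.2] [cite: MazurRubin2007, Prop. 5.2]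
[cite: Kramer1981, Prop. 7] -/
theorem selmerGroup_inf_primeTwist_selmerGroup_eq_kummerStrict_of_unram (hd : DescAdmissibleUnram W d) (hχ : IsQuadraticCharacterOf χ d)
    (w : InfinitePlace ℚ) :
    W.selmerGroup ((2 : ℕ) : ℤ) ⊓ PrimeTwist.selmerGroup W χ = (kummerStrict W 2 {(Sum.inl w : Place ℚ)}).selmerGroup := by
  refine le_antisymm (fun c hc ↦ ?_) (le_inf (selmerGroup_kummerStrict_singleton_inl_le_selmerGroup W w)
    (selmerGroup_kummerStrict_le_primeTwist_selmerGroup_of_unram W hd hχ w))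
  obtain ⟨hS, hP⟩ := AddSubgroup.mem_inf.mp hc
  have hS' : c ∈ selmerGroupRelaxedAtInfinityAtTwo W ⊓ ⨅ w : InfinitePlace ℚ, W.selmerLocalKer w.Completion ((2 : ℕ) : ℤ) := by
    rw [selmerGroupRelaxedAtInfinityAtTwo_inf_infinitePlaces]
    exact hS
  obtain ⟨hR, hinf⟩ := AddSubgroup.mem_inf.mp hS'
  have hW : c ∈ W.selmerLocalKer w.Completion ((2 : ℕ) : ℤ) := (AddSubgroup.mem_iInf.mp hinf) w
  have hA : c ∈ PrimeTwist.selmerLocalKer W χ w.Completion := ((PrimeTwist.mem_selmerGroup_iff W χ c).mp hP).2 w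
  exact (mem_selmerGroup_kummerStrict_singleton_inl_iff W w c).mpr ⟨hR, localization_inl_eq_zero_of_mem_of_mem_of_neg W hd.1 hχ w hW hA⟩

/-! ## §U5 The `Δ > 0` lattice -/

/-- **`Δ_W > 0`, `d` unramified-admissible: `Sel_𝔓(A_χ/ℚ)` is `Sel₂^{str ∞}(W)` or `Sel₂^{rel ∞}(W)`** (the sandwich of §U3 inside an index-`2` pair).
[cite: MazurRubin2010, Lemma 3.2 and Prop. 3.3] -/
theorem primeTwist_selmerGroup_eq_kummerStrict_or_eq_relaxed_of_Δ_pos_of_unram (hΔ : 0 < W.Δ) (hd : DescAdmissibleUnram W d)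
    (hχ : IsQuadraticCharacterOf χ d) (w : InfinitePlace ℚ) :
    PrimeTwist.selmerGroup W χ = (kummerStrict W 2 {(Sum.inl w : Place ℚ)}).selmerGroup ∨
      PrimeTwist.selmerGroup W χ = selmerGroupRelaxedAtInfinityAtTwo W :=
  eq_or_eq_of_relIndex_eq_two (selmerGroup_kummerStrict_le_primeTwist_selmerGroup_of_unram W hd hχ w)
    (primeTwist_selmerGroup_le_selmerGroupRelaxedAtInfinityAtTwo_of_unram W hd hχ)
    (relIndex_kummerStrict_selmerGroupRelaxedAtInfinityAtTwo_eq_two_of_Δ_pos W hΔ w)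

/-- **Selmer egg bit `1` ⟹ DOWN** (unramified-admissible `d`): if `Sel₂^{rel ∞}(W) ≤ Sel₂(W)` then `Sel_𝔓(A_χ/ℚ) = Sel₂^{str ∞}(W)` (`Sel_𝔓 ≤ rel = Sel₂`
and `Sel₂ ⊓ Sel_𝔓 = str`). [cite: MazurRubin2010, Lemma 3.2 and Prop. 3.3] [cite: Kramer1981, Prop. 7] -/
theorem primeTwist_selmerGroup_eq_kummerStrict_of_relaxed_le_selmerGroup_of_unram (hd : DescAdmissibleUnram W d)
    (hχ : IsQuadraticCharacterOf χ d) (w : InfinitePlace ℚ) (hR : selmerGroupRelaxedAtInfinityAtTwo W ≤ W.selmerGroup ((2 : ℕ) : ℤ)) :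
    PrimeTwist.selmerGroup W χ = (kummerStrict W 2 {(Sum.inl w : Place ℚ)}).selmerGroup := by
  rw [← selmerGroup_inf_primeTwist_selmerGroup_eq_kummerStrict_of_unram W hd hχ w]
  exact (inf_eq_right.mpr ((primeTwist_selmerGroup_le_selmerGroupRelaxedAtInfinityAtTwo_of_unram W hd hχ).trans hR)).symm

/-- **`Sel₂(W) ≤ Sel_𝔓(A_χ/ℚ) ↔` every `2`-Selmer class of `W` is trivial at `∞`** (unramified-admissible `d`; any sign of `Δ`).
[cite: MazurRubin2010, Lemma 3.2] [cite: Kramer1981, Prop. 7] -/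
theorem selmerGroup_le_primeTwist_selmerGroup_iff_forall_localization_eq_zero_of_unram (hd : DescAdmissibleUnram W d)
    (hχ : IsQuadraticCharacterOf χ d) (w : InfinitePlace ℚ) :
    W.selmerGroup ((2 : ℕ) : ℤ) ≤ PrimeTwist.selmerGroup W χ ↔
      ∀ c ∈ W.selmerGroup ((2 : ℕ) : ℤ), galoisCohomology.localization (W.torsionGaloisModule ((2 : ℕ) : ℤ)) (Sum.inl w) 1 c = 0 := by
  constructor
  · intro hle c hc
    have hc' : c ∈ (kummerStrict W 2 {(Sum.inl w : Place ℚ)}).selmerGroup := by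
      rw [← selmerGroup_inf_primeTwist_selmerGroup_eq_kummerStrict_of_unram W hd hχ w]
      exact AddSubgroup.mem_inf.mpr ⟨hc, hle hc⟩
    exact ((mem_selmerGroup_kummerStrict_singleton_inl_iff W w c).mp hc').2
  · intro hall
    rw [selmerGroup_eq_selmerGroup_kummerStrict_of_forall_localization_eq_zero W w hall]
    exact selmerGroup_kummerStrict_le_primeTwist_selmerGroup_of_unram W hd hχ w

/-- **Selmer egg bit `0` ⟹ the UP dichotomy with counts** (`Δ_W > 0`, `d` unramified-admissible): `Sel_𝔓(A_χ/ℚ) = Sel₂(W)` or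
`Sel_𝔓(A_χ/ℚ) = Sel₂^{rel ∞}(W) ⊋ Sel₂(W)`, so `#Sel_𝔓(A_χ) ∈ {#Sel₂(W), 2·#Sel₂(W)}`. [cite: MazurRubin2010, Lemma 3.2 and Prop. 3.3] [cite: Kramer1981, Thm. 1] -/
theorem primeTwist_selmerGroup_eq_or_eq_of_forall_localization_eq_zero_of_unram (hΔ : 0 < W.Δ) (hd : DescAdmissibleUnram W d)
    (hχ : IsQuadraticCharacterOf χ d) (w : InfinitePlace ℚ)
    (hall : ∀ c ∈ W.selmerGroup ((2 : ℕ) : ℤ), galoisCohomology.localization (W.torsionGaloisModule ((2 : ℕ) : ℤ)) (Sum.inl w) 1 c = 0) :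
    (PrimeTwist.selmerGroup W χ = W.selmerGroup ((2 : ℕ) : ℤ) ∨ PrimeTwist.selmerGroup W χ = selmerGroupRelaxedAtInfinityAtTwo W) ∧
      (Nat.card (PrimeTwist.selmerGroup W χ) = selmerTwoCard W ∨ Nat.card (PrimeTwist.selmerGroup W χ) = 2 * selmerTwoCard W) := by
  have hSel := selmerGroup_eq_selmerGroup_kummerStrict_of_forall_localization_eq_zero W w hall
  have hR : Nat.card (selmerGroupRelaxedAtInfinityAtTwo W) = 2 * selmerTwoCard W := by
    rw [natCard_selmerGroupRelaxedAtInfinityAtTwo_eq_mul W,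
      (relIndex_selmerGroup_selmerGroupRelaxedAtInfinityAtTwo_eq_two_iff_of_Δ_pos W hΔ w).mpr hall, mul_comm]
  rcases primeTwist_selmerGroup_eq_kummerStrict_or_eq_relaxed_of_Δ_pos_of_unram W hΔ hd hχ w with h | h
  · rw [← hSel] at h
    exact ⟨Or.inl h, Or.inl (by rw [h]; rfl)⟩
  · exact ⟨Or.inr h, Or.inr (by rw [h, hR])⟩

/-! ## §U6 UP, DOWN, DECIDED -/

/-- **THE UP DECISION for `d ≡ 5 (mod 8)`.** `Δ_W > 0`, `E(ℚ)[2] = 0`, `d` unramified-admissible with character `χ`, every `2`-Selmer class of `W`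
trivial at `∞` ⟹ `Sel_𝔓(A_χ/ℚ) = Sel₂^{rel ∞}(W)` and `#Sel_𝔓(A_χ) = 2·#Sel₂(W)`: §U5 gives `#Sel_𝔓 ∈ {#Sel₂, 2·#Sel₂}`, T-A⁵
(`unramifiedTwistSelmerShiftAtTwo_holds`, model currency) gives `#Sel₂(W^{(d)}) ∈ {#Sel₂/2, 2·#Sel₂}`, the model dictionary identifies the counts.
[cite: Kramer1981, Thm. 1, Prop. 3 and Prop. 7] [cite: MazurRubin2010, Lemma 3.2 and Prop 3.3] [cite: MazurRubin2007, §3 and Def 4.3] -/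
theorem primeTwist_selmerGroup_eq_relaxed_of_forall_localization_eq_zero_of_unram (hΔ : 0 < W.Δ) (hT : NoRationalTwoTorsion W)
    (hd : DescAdmissibleUnram W d) (hχ : IsQuadraticCharacterOf χ d) (w : InfinitePlace ℚ)
    (hall : ∀ c ∈ W.selmerGroup ((2 : ℕ) : ℤ),
      galoisCohomology.localization (W.torsionGaloisModule ((2 : ℕ) : ℤ)) (Sum.inl w) 1 c = 0) :
    PrimeTwist.selmerGroup W χ = selmerGroupRelaxedAtInfinityAtTwo W ∧
      Nat.card (PrimeTwist.selmerGroup W χ) = 2 * selmerTwoCard W := by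
  have hd0 : d ≠ 0 := hd.1.ne
  haveI : Finite (W.selmerGroup ((2 : ℕ) : ℤ)) := W.finite_selmerGroup_holds (by norm_num)
  have hS0 : selmerTwoCard W ≠ 0 := by
    change Nat.card (W.selmerGroup ((2 : ℕ) : ℤ)) ≠ 0
    exact Nat.card_pos.ne'
  have hdict : twistSelmerTwoCard W d = Nat.card (PrimeTwist.selmerGroup W χ) :=
    (natCard_primeTwist_selmerGroup_eq_twistSelmerTwoCard W hd0 hχ).symm
  have hTA := unramifiedTwistSelmerShiftAtTwo_holds W hΔ hT d hd
  rw [hdict] at hTA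
  have hcount : Nat.card (PrimeTwist.selmerGroup W χ) = 2 * selmerTwoCard W := by
    rcases (primeTwist_selmerGroup_eq_or_eq_of_forall_localization_eq_zero_of_unram W hΔ hd hχ w hall).2 with h | h
    · exfalso
      rw [h] at hTA
      rcases hTA with h' | h' <;> omega
    · exact h
  exact ⟨primeTwist_selmerGroup_eq_relaxed_of_unram_of_natCard W hd hχ hcount, hcount⟩

/-- **DOWN for `d ≡ 5 (mod 8)`: some `Sel₂(W)`-class non-trivial at `∞` ⟹ `Sel_𝔓(A_χ/ℚ) = Sel₂^{str ∞}(W)`** (`Δ_W > 0`, `d` unramified-admissible;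
no torsion or `Ш` hypothesis): such a class forces `Sel₂(W) = Sel₂^{rel ∞}(W)`, then §U5's «egg bit `1` ⟹ DOWN». [cite: Kramer1981, Prop. 7 and Thm. 1]
[cite: MazurRubin2010, Lemma 3.2 and Prop 3.3] -/
theorem primeTwist_selmerGroup_eq_kummerStrict_of_exists_localization_ne_zero_of_unram (hΔ : 0 < W.Δ) (hd : DescAdmissibleUnram W d)
    (hχ : IsQuadraticCharacterOf χ d) (w : InfinitePlace ℚ)
    (hex : ∃ c ∈ W.selmerGroup ((2 : ℕ) : ℤ), galoisCohomology.localization (W.torsionGaloisModule ((2 : ℕ) : ℤ)) (Sum.inl w) 1 c ≠ 0) :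
    PrimeTwist.selmerGroup W χ = (kummerStrict W 2 {(Sum.inl w : Place ℚ)}).selmerGroup := by
  apply primeTwist_selmerGroup_eq_kummerStrict_of_relaxed_le_selmerGroup_of_unram W hd hχ w
  rcases selmerGroup_eq_kummerStrict_or_eq_relaxed_of_Δ_pos W hΔ w with h | h
  · exfalso
    obtain ⟨c, hc, hne⟩ := hex
    rw [h] at hc
    exact hne ((mem_selmerGroup_kummerStrict_singleton_inl_iff W w c).mp hc).2
  · exact h.symm.le

/-- **WHICH END, DECIDED, for `d ≡ 5 (mod 8)`** (`Δ_W > 0`, `E(ℚ)[2] = 0`, `d` unramified-admissible — `W` good at `2`): `Sel_𝔓(A_χ/ℚ) = Sel₂^{rel ∞}(W)`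
if every `Sel₂(W)`-class is trivial at `∞`, and `Sel_𝔓(A_χ/ℚ) = Sel₂^{str ∞}(W)` otherwise — the statement of file 41's
`primeTwist_selmerGroup_eq_relaxed_or_eq_kummerStrict_decided` with `DescAdmissibleUnram` for `DescAdmissible` (Mazur–Rubin 2010 Lemma 2.10 (v) at the
inert place `2`). [cite: Kramer1981, Thm. 1 and Prop. 7] [cite: MazurRubin2010, Lemma 2.10 (v), Prop 3.3] -/
theorem primeTwist_selmerGroup_eq_relaxed_or_eq_kummerStrict_decided_of_unram (hΔ : 0 < W.Δ) (hT : NoRationalTwoTorsion W)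
    (hd : DescAdmissibleUnram W d) (hχ : IsQuadraticCharacterOf χ d) (w : InfinitePlace ℚ) :
    ((∀ c ∈ W.selmerGroup ((2 : ℕ) : ℤ), galoisCohomology.localization (W.torsionGaloisModule ((2 : ℕ) : ℤ)) (Sum.inl w) 1 c = 0) ∧
        PrimeTwist.selmerGroup W χ = selmerGroupRelaxedAtInfinityAtTwo W) ∨
      ((∃ c ∈ W.selmerGroup ((2 : ℕ) : ℤ), galoisCohomology.localization (W.torsionGaloisModule ((2 : ℕ) : ℤ)) (Sum.inl w) 1 c ≠ 0) ∧
        PrimeTwist.selmerGroup W χ = (kummerStrict W 2 {(Sum.inl w : Place ℚ)}).selmerGroup) := by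
  by_cases hall : ∀ c ∈ W.selmerGroup ((2 : ℕ) : ℤ), galoisCohomology.localization (W.torsionGaloisModule ((2 : ℕ) : ℤ)) (Sum.inl w) 1 c = 0
  · exact Or.inl ⟨hall, (primeTwist_selmerGroup_eq_relaxed_of_forall_localization_eq_zero_of_unram W hΔ hT hd hχ w hall).1⟩
  · push Not at hall
    exact Or.inr ⟨hall, primeTwist_selmerGroup_eq_kummerStrict_of_exists_localization_ne_zero_of_unram W hΔ hd hχ w hall⟩

/-- **WHICH END, DECIDED — CLASS-FREE FORM**: the same conclusion from `DescAdmissible W d ∨ DescAdmissibleUnram W d` (`d ≡ 1 (mod 8)`, or `d ≡ 5 (mod 8)`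
with `W` good at `2`), i.e. for EVERY descent-admissible `d` with `2` unramified in `ℚ(√d)` — the shape a Heegner field with odd `d_K` supplies.
[cite: Kramer1981, Thm. 1 and Prop. 7] [cite: MazurRubin2010, Lemma 2.10 (v), Prop 3.3] -/
theorem primeTwist_selmerGroup_eq_relaxed_or_eq_kummerStrict_decided_of_descAdmissible_or_unram (hΔ : 0 < W.Δ)
    (hT : NoRationalTwoTorsion W) (hd : DescAdmissible W d ∨ DescAdmissibleUnram W d) (hχ : IsQuadraticCharacterOf χ d)
    (w : InfinitePlace ℚ) :
    ((∀ c ∈ W.selmerGroup ((2 : ℕ) : ℤ), galoisCohomology.localization (W.torsionGaloisModule ((2 : ℕ) : ℤ)) (Sum.inl w) 1 c = 0) ∧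
        PrimeTwist.selmerGroup W χ = selmerGroupRelaxedAtInfinityAtTwo W) ∨
      ((∃ c ∈ W.selmerGroup ((2 : ℕ) : ℤ), galoisCohomology.localization (W.torsionGaloisModule ((2 : ℕ) : ℤ)) (Sum.inl w) 1 c ≠ 0) ∧
        PrimeTwist.selmerGroup W χ = (kummerStrict W 2 {(Sum.inl w : Place ℚ)}).selmerGroup) := by
  rcases hd with hd | hd
  · exact primeTwist_selmerGroup_eq_relaxed_or_eq_kummerStrict_decided W hΔ hT hd hχ w
  · exact primeTwist_selmerGroup_eq_relaxed_or_eq_kummerStrict_decided_of_unram W hΔ hT hd hχ w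

/-! ## §U7 Mixed rigidity: `Sel_𝔓(A_{χ_d})` is the same group for split- and unramified-admissible `d` -/

/-- **MIXED RIGIDITY — T-A⁵′ `MixedTwistSelmerLevelAtTwo` as an equality of groups: `Sel_𝔓(A_{χ_d}/ℚ) = Sel_𝔓(A_{χ_{d'}}/ℚ)` inside `H¹(ℚ, E[2])`**
for `d, d'` each split- or unramified-admissible (`Δ_W > 0`, `E(ℚ)[2] = 0`): both are `Sel₂^{rel ∞}(W)` or both `Sel₂^{str ∞}(W)`, according to the
`∞`-bit of `Sel₂(W)` alone. [cite: Kramer1981, Thm. 1, Prop. 6] [cite: MazurRubin2010, Prop 3.3, Cor 3.4] -/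
theorem primeTwist_selmerGroup_eq_of_descAdmissible_or_unram (hΔ : 0 < W.Δ) (hT : NoRationalTwoTorsion W)
    (hd : DescAdmissible W d ∨ DescAdmissibleUnram W d) (hχ : IsQuadraticCharacterOf χ d)
    (hd' : DescAdmissible W d' ∨ DescAdmissibleUnram W d') (hχ' : IsQuadraticCharacterOf χ' d') :
    PrimeTwist.selmerGroup W χ = PrimeTwist.selmerGroup W χ' := by
  rcases primeTwist_selmerGroup_eq_relaxed_or_eq_kummerStrict_decided_of_descAdmissible_or_unram W hΔ hT hd hχ Rat.infinitePlace with
    ⟨hall, h⟩ | ⟨hex, h⟩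
  · rcases primeTwist_selmerGroup_eq_relaxed_or_eq_kummerStrict_decided_of_descAdmissible_or_unram W hΔ hT hd' hχ' Rat.infinitePlace with
      ⟨-, h'⟩ | ⟨⟨c, hc, hne⟩, -⟩
    · rw [h, h']
    · exact absurd (hall c hc) hne
  · rcases primeTwist_selmerGroup_eq_relaxed_or_eq_kummerStrict_decided_of_descAdmissible_or_unram W hΔ hT hd' hχ' Rat.infinitePlace with
      ⟨hall, -⟩ | ⟨-, h'⟩
    · obtain ⟨c, hc, hne⟩ := hex
      exact absurd (hall c hc) hne
    · rw [h, h']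

/-- **… and the counts agree** (T-A⁵′ recovered from the group equality). [cite: Kramer1981, Prop. 6] [cite: MazurRubin2010, Cor 3.4] -/
theorem natCard_primeTwist_selmerGroup_eq_of_descAdmissible_or_unram (hΔ : 0 < W.Δ) (hT : NoRationalTwoTorsion W)
    (hd : DescAdmissible W d ∨ DescAdmissibleUnram W d) (hχ : IsQuadraticCharacterOf χ d)
    (hd' : DescAdmissible W d' ∨ DescAdmissibleUnram W d') (hχ' : IsQuadraticCharacterOf χ' d') :
    Nat.card (PrimeTwist.selmerGroup W χ) = Nat.card (PrimeTwist.selmerGroup W χ') := by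
  rw [primeTwist_selmerGroup_eq_of_descAdmissible_or_unram W hΔ hT hd hχ hd' hχ']

end Summit.BirchSwinnertonDyer.BirchSwinnertonDyer.Theorems.GenusKolyArch

end
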